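import Summits.ResolutionOfSingularities.ResolutionOfSingularities.Theorems.FrobeniusClosingSteerLowTowerMoves
import Literature.AlgebraicGeometry.Resolution.LocalBlowup
import Mathlib.RingTheory.EssentialFiniteness
import HarnessLib

/-!
# D3a part 3b (frame): the surface germ `φ(R)` of a member `R = (B)_{𝔪_O ∩ B}` is a `k`-subalgebra essentially of finite type
(res-D-pv-012 AS res-L0-w41-stub-8; W4.1 crux `Steer`, LOW branch, strat-2 §σ2.24 `IsLowTowerTwo` clause (T1).) OURS; AI.

For the images frame of `FrobeniusClosingSteerLowTowerMoves` (`A n := φ(R n)` for members `R n ≤ Λ` and a residue map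
`φ : Λ → κ`), the three algebraic inputs of clause (T1) of the LOW tower: `φ(R)` is essentially of finite type over `k`
(`essFiniteType_of_toSubring_eq_map_locAtCentre`), regular local of the dimension of `R ⧸ P` when `P` is the kernel of the
restricted residue map and `R ⧸ P` is regular (`isRegularLocalRing_map_of_quotient`), and has perfect residue field in
characteristic `2` when `R` has (`forall_exists_sub_sq_mem_maximalIdeal_map`).
-/

noncomputable section
set_option linter.dupNamespace false

namespace Summit.ResolutionOfSingularities.ResolutionOfSingularities.Theorems.SwitchingDichotomy.LowTower

open IsLocalRing
open Literature.AlgebraicGeometry.Resolution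

variable {k K κ : Type} [Field k] [Field K] [Field κ] [Algebra k K] [Algebra k κ]

/-- **(T1-frame) The surface germ is essentially of finite type over `k`**: for `R = (B)_{𝔪_O ∩ B}` with `B ⊆ O` a finitely generated
`k`-subalgebra and `R ≤ Λ`, any `k`-subalgebra `A ⊆ κ` whose underlying ring is the image `φ(R)` (for a `k`-compatible residue map `φ`)
is essentially of finite type over `k` (surjective image of a localisation of a finite-type algebra). [folklore] -/
theorem essFiniteType_of_toSubring_eq_map_locAtCentre (Λ : Subring K) (φ : Λ →+* κ) (hkΛ : ∀ c : k, algebraMap k K c ∈ Λ)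
    (hφ : ∀ c : k, φ ⟨algebraMap k K c, hkΛ c⟩ = algebraMap k κ c)
    (O : ValuationSubring K) (B : Subalgebra k K) (hB : B.FG) (hBO : B.toSubring ≤ O.toSubring)
    (hR : locAtCentre B.toSubring O ≤ Λ) (A : Subalgebra k κ)
    (hA : A.toSubring = ((locAtCentre B.toSubring O).comap Λ.subtype).map φ) :
    Algebra.EssFiniteType k A := by
  set R := locAtCentre B.toSubring O with hRdef
  -- `k`-algebra structures on `R`; `R` is essentially of finite type over `k` (localisation of the finite-type algebra `B`)
  have hkR : ∀ c : k, algebraMap k K c ∈ R := fun c => le_locAtCentre _ O (B.algebraMap_mem c)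
  letI : Algebra k R := ((algebraMap k K).codRestrict R hkR).toAlgebra
  letI : Algebra B.toSubring R := (Subring.inclusion (le_locAtCentre B.toSubring O)).toAlgebra
  letI : Algebra k B.toSubring := B.algebra
  haveI : IsScalarTower k B.toSubring R := IsScalarTower.of_algebraMap_eq (fun c => rfl)
  haveI : Algebra.FiniteType k B.toSubring := B.fg_iff_finiteType.mp hB
  haveI hloc := isLocalization_locAtCentre hBO
  haveI : Algebra.EssFiniteType B.toSubring R :=
    Algebra.EssFiniteType.of_isLocalization R (subringCentre B.toSubring O hBO).primeCompl
  haveI : Algebra.EssFiniteType k R := Algebra.EssFiniteType.comp k B.toSubring R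
  -- the restricted residue map `R → A` as a surjective `k`-algebra map
  let ψ₀ : R →+* κ := φ.comp (Subring.inclusion hR)
  have hψ₀ : ∀ r : R, ψ₀ r = φ ⟨(r : K), hR r.2⟩ := fun r => rfl
  have hmem : ∀ r : R, ψ₀ r ∈ A := fun r => by
    rw [← Subalgebra.mem_toSubring, hA, hψ₀]
    exact (mem_map_comap_iff Λ φ R _).mpr ⟨⟨(r : K), hR r.2⟩, r.2, rfl⟩
  let ψ : R →ₐ[k] A :=
    { ψ₀.codRestrict A hmem with
      commutes' := fun c => Subtype.ext (by
        change ψ₀ ⟨algebraMap k K c, hkR c⟩ = algebraMap k κ c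
        rw [hψ₀]
        exact hφ c) }
  have hψs : Function.Surjective ψ := by
    rintro ⟨a, ha⟩
    rw [← Subalgebra.mem_toSubring, hA] at ha
    obtain ⟨r, hr, rfl⟩ := (mem_map_comap_iff Λ φ R a).mp ha
    exact ⟨⟨(r : K), hr⟩, Subtype.ext rfl⟩
  exact Algebra.EssFiniteType.of_surjective ψ hψs

/-- **(T1-frame) Regularity and dimension of the surface germ**: if the restricted residue map `R → φ(R)` has kernel `P` and `R ⧸ P` is
a regular local ring, then the image `φ(R)` is a regular local ring of the same Krull dimension (first isomorphism theorem and transport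
along the induced isomorphism `R ⧸ P ≃ φ(R)`). [folklore] -/
theorem isRegularLocalRing_map_of_quotient (Λ : Subring K) (φ : Λ →+* κ) (R : Subring K) (hR : R ≤ Λ) (P : Ideal R)
    (hP : ∀ r : R, r ∈ P ↔ φ ⟨(r : K), hR r.2⟩ = 0) [IsRegularLocalRing (R ⧸ P)] :
    IsRegularLocalRing ((R.comap Λ.subtype).map φ) ∧
      ringKrullDim ((R.comap Λ.subtype).map φ) = ringKrullDim (R ⧸ P) := by
  let ψ₀ : R →+* κ := φ.comp (Subring.inclusion hR)
  have hψ₀ : ∀ r : R, ψ₀ r = φ ⟨(r : K), hR r.2⟩ := fun r => rfl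
  have hmem : ∀ r : R, ψ₀ r ∈ (R.comap Λ.subtype).map φ := fun r =>
    (mem_map_comap_iff Λ φ R _).mpr ⟨⟨(r : K), hR r.2⟩, r.2, rfl⟩
  let ψ : R →+* (R.comap Λ.subtype).map φ := ψ₀.codRestrict _ hmem
  have hψs : Function.Surjective ψ := by
    rintro ⟨a, ha⟩
    obtain ⟨r, hr, rfl⟩ := (mem_map_comap_iff Λ φ R a).mp ha
    exact ⟨⟨(r : K), hr⟩, Subtype.ext rfl⟩
  have hker : RingHom.ker ψ = P := by
    ext r
    rw [RingHom.mem_ker, hP r, ← hψ₀]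
    exact ⟨fun h => congrArg Subtype.val h, fun h => Subtype.ext h⟩
  let e : (R ⧸ P) ≃+* (R.comap Λ.subtype).map φ :=
    (Ideal.quotEquivOfEq hker.symm).trans (RingHom.quotientKerEquivOfSurjective hψs)
  exact ⟨IsRegularLocalRing.of_ringEquiv e, (ringKrullDim_eq_of_ringEquiv e).symm⟩

/-- **(T1-frame) Perfect residue field of the surface germ**: if every element of the local member `R` is a square modulo `𝔪_R`,
then every element of the (local) image `φ(R)` is a square modulo its maximal ideal (push forward along the surjective, hence local,
restricted residue map). [folklore] -/
theorem forall_exists_sub_sq_mem_maximalIdeal_map (Λ : Subring K) (φ : Λ →+* κ) (R : Subring K) (hR : R ≤ Λ) [IsLocalRing R]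
    (h : ∀ r : R, ∃ b : R, r - b ^ 2 ∈ maximalIdeal R) [IsLocalRing ((R.comap Λ.subtype).map φ)]
    (a : (R.comap Λ.subtype).map φ) : ∃ b : (R.comap Λ.subtype).map φ, a - b ^ 2 ∈ maximalIdeal _ := by
  obtain ⟨ψ, hψs, -⟩ := exists_surjective_restrict Λ φ R hR
  haveI := IsLocalHom.of_surjective ψ hψs
  obtain ⟨r, rfl⟩ := hψs a
  obtain ⟨b, hb⟩ := h r
  refine ⟨ψ b, ?_⟩
  rw [← map_pow, ← map_sub]
  exact fun hu => hb ((isUnit_map_iff ψ _).mp hu)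

end Summit.ResolutionOfSingularities.ResolutionOfSingularities.Theorems.SwitchingDichotomy.LowTower

end
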